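import Summits.Ventures.Crystal3D.Theorems.StickyWulffConstantCoaxialWallLawSeamSealedRow
import HarnessLib

/-!
# The GRADED row: junk-monotone credit `12 − deg_Y`, and the certificate input of record to build `UnionCoreGradedCapWin₃ s` (cf-p1 (cclxxxviii)(1))
# (crux `CoaxialWallLaw`, stmt-Ventures-19481; line `WallLedgerF`, skeleton 'CoaxialWallLawCertificates' v8.3R → v8.5; T5b row half)

HONEST FRAMING. Venture `Summits/Ventures/Crystal3D` (cell `crystal3d-full`); sequel of '…SeamSealedRow', whose input `UnionCoreSealedCapWin₃ (2√6)` is refuted in the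
kernel ('…SeamSealedRowRefuted', `ZTerm.not_unionCoreSealedCapWin₃`: the unfloored payer term; cf-p2 K-SEAL: all-or-nothing sealing).  Both refutations exploit
that ONE junk contact zeroes a ball's certified credit.  The repair of record (cf-p2 R2, cf-p1 (cclxxxviii)(1)) makes the credit LINEAR IN JUNK: the GRADED
gain of a core ball `y` is its true deficiency in the WINDOW, `12 − #(Y-contacts of y)` — every contact, core or junk, costs exactly one.  No cap table, no case split,
and E1 drops out of the comparison.
* `gradedGain X y := (12 − deg_X y)⁺` (`= 12 − deg_X y` on a `1`-separated `X`: `gradedGain_eq`), `gradedPool`, `gradedPool₃` (payer unit `max 1 ·`, floor `3` at loaded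
  `b ≠ z` — verbatim the shapes of `sealedPool`/`sealedPool₃`), `gradedSummand₃`;
* `gradedPool_le_pooledDef` (NO junk hypothesis), `gradedPool₃_le_pooledDef (h3 : ThreePayer)`, **`localSummandA_le_gradedSummand₃_unionCoreStar (h3)`** (no E1);
* **`UnionCoreGradedCapWin₃ s`** (NAMED INPUT — the row certificate of record to build: payer `0`, `Y ⊆ B̄(0,3)`, standard systems, star-closed union core, graded pools,
  floor 3 at `b ≠ 0`), `unionCoreGradedCapWin₃_mono`, **`localSummandA_le_of_threePayer_of_gradedWin₃ (h3) (h)`** (every frame, every payer; transport + radius-3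
  locality as in '…SeamSealedRow'), **`t5b_of_threePayer_of_gradedWin₃ : ThreePayer → UnionCoreGradedCapWin₃ (2 * Real.sqrt 6) → CoherentSeamSmall (2√6) 3 ∧
  IncoherentSeamSmall (2√6) 3`** — the by-name closer for `stub_t5bOfThreePayer` given a registered `stub_unionCoreGradedCapWin3`.
NUMBERS OF RECORD (graded functional F_R2, exact; cf-p2 g22 certificates / 19481-p1 g20 certprobe j335809): deca + 2 vac `1923/440 = 4.3705` (junk-immune, max over
the anchors), icosa core `≤ 49/12` certified / `1091/546` on the model window, Σ9 `≤ 56/15` / `8/7`, re-entrant `≤ 103/30` / `283/171`; adversarial junk (K-ADV/LS v3)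
`≤ 2.03`; into-z witnesses W5/W6 `5/53`, `≈ 0.1`.  WHY IT MIGHT FAIL: only the real one — K2, `≥ 15` narrow-mover ends on one payer sphere (best known 11; into the
payer at most 7, costing 10 of the 11 contacts, 19481-p1 j335757/8); and the payer floor: at `b = z` the pool is only `12 − deg z + …` (see '…SeamSealedRowRefuted'),
harmless here because the graded credit of the payer's unsaturated contacts is counted in full.
WHAT THIS IS NOT: the certificate is NOT proved; `ThreePayer` is NOT proved; F-C1 not moved.
-/

noncomputable section

namespace Summit.Ventures.Crystal3D.Theorems

namespace TailResidue

open Summit.Ventures.Crystal3D Finset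
open scoped InnerProductSpace

/-! ### The graded gain -/

open scoped Classical in
/-- **THE GRADED GAIN** of the ball `y` in the window `X`: its true deficiency `12 − #(contacts of y in X)`, clipped at `0` (the clip is inactive on a `1`-separated `X`). -/
def gradedGain (X : Finset (EuclideanSpace ℝ (Fin 3))) (y : EuclideanSpace ℝ (Fin 3)) : ℝ :=
  max 0 ((12 : ℝ) - ((X.filter fun q => dist y q = 1).card : ℝ))

/-- Graded gains are nonnegative. -/
theorem gradedGain_nonneg (X : Finset (EuclideanSpace ℝ (Fin 3))) (y : EuclideanSpace ℝ (Fin 3)) : 0 ≤ gradedGain X y := le_max_left _ _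

open scoped Classical in
/-- On a `1`-separated window the clip is inactive: `gradedGain X y = 12 − deg_X y`. -/
theorem gradedGain_eq {X : Finset (EuclideanSpace ℝ (Fin 3))} (hX : ∀ p ∈ X, ∀ q ∈ X, p ≠ q → 1 ≤ dist p q) (y : EuclideanSpace ℝ (Fin 3)) :
    gradedGain X y = (12 : ℝ) - ((X.filter fun q => dist y q = 1).card : ℝ) := by
  unfold gradedGain
  have : ((X.filter fun q => dist y q = 1).card : ℝ) ≤ 12 := by exact_mod_cast card_filter_dist_eq_one_le_twelve X hX y
  exact max_eq_right (by linarith)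

open scoped Classical in
/-- **Soundness of the graded row** (one line): the graded gain never exceeds the true deficiency. -/
theorem gradedGain_le_deficiency {X : Finset (EuclideanSpace ℝ (Fin 3))} (hX : ∀ p ∈ X, ∀ q ∈ X, p ≠ q → 1 ≤ dist p q) (y : EuclideanSpace ℝ (Fin 3)) :
    gradedGain X y ≤ (12 : ℝ) - ((X.filter fun q => dist y q = 1).card : ℝ) := (gradedGain_eq hX y).le

/-! ### Graded pools and the functional -/

open scoped Classical in
/-- **THE GRADED POOL** of the core ball `b` at the payer `z`: the payer's unit (or its graded gain if larger) plus the graded gains of the other core balls within `1` of `b`. -/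
def gradedPool (X D : Finset (EuclideanSpace ℝ (Fin 3))) (z b : EuclideanSpace ℝ (Fin 3)) : ℝ :=
  (if z ∈ D then max 1 (gradedGain X z) else 1) + ∑ y ∈ (D.erase z).filter (fun y => dist b y ≤ 1), gradedGain X y

open scoped Classical in
/-- **THE THREE-PAYER-FLOORED GRADED POOL**: `gradedPool` at the payer, `max 3 gradedPool` elsewhere. -/
def gradedPool₃ (X D : Finset (EuclideanSpace ℝ (Fin 3))) (z b : EuclideanSpace ℝ (Fin 3)) : ℝ :=
  if b = z then gradedPool X D z b else max 3 (gradedPool X D z b)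

open scoped Classical in
/-- **THE GRADED FLOOR-3 (A)-SUMMAND** of the core `D` of the window `X` at the payer `z`. -/
def gradedSummand₃ (v : WordVersion) (S₁ S₂ : PlateSystem) (X D : Finset (EuclideanSpace ℝ (Fin 3))) (z : EuclideanSpace ℝ (Fin 3)) : ℝ :=
  ∑ b ∈ D.filter (fun b => dist z b ≤ 1 ∧ 0 < endMultA D v S₁ S₂ b), (endMultA D v S₁ S₂ b : ℝ) / gradedPool₃ X D z b

open scoped Classical in
/-- The graded pool is at least `1`. -/
theorem one_le_gradedPool (X D : Finset (EuclideanSpace ℝ (Fin 3))) (z b : EuclideanSpace ℝ (Fin 3)) : 1 ≤ gradedPool X D z b := by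
  unfold gradedPool
  have h1 : (1 : ℝ) ≤ if z ∈ D then max 1 (gradedGain X z) else 1 := by
    split_ifs
    · exact le_max_left _ _
    · exact le_rfl
  have h2 : (0 : ℝ) ≤ ∑ y ∈ (D.erase z).filter (fun y => dist b y ≤ 1), gradedGain X y := sum_nonneg fun y _ => gradedGain_nonneg X y
  linarith

open scoped Classical in
/-- The floor-3 graded pool is positive. -/
theorem gradedPool₃_pos (X D : Finset (EuclideanSpace ℝ (Fin 3))) (z b : EuclideanSpace ℝ (Fin 3)) : 0 < gradedPool₃ X D z b := by
  unfold gradedPool₃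
  split_ifs
  · exact lt_of_lt_of_le one_pos (one_le_gradedPool X D z b)
  · exact lt_of_lt_of_le (by norm_num) (le_max_left _ _)

open scoped Classical in
/-- **The graded pool never exceeds the true pool** (no junk hypothesis: every credited ball is a payer within `1` of `b`, credited with at most its deficiency). -/
theorem gradedPool_le_pooledDef {X D : Finset (EuclideanSpace ℝ (Fin 3))} (hX : ∀ p ∈ X, ∀ q ∈ X, p ≠ q → 1 ≤ dist p q) (hDX : D ⊆ X) {z : EuclideanSpace ℝ (Fin 3)}
    (hz : z ∈ X) (hdeg : (X.filter fun q => dist z q = 1).card ≤ 11) {b : EuclideanSpace ℝ (Fin 3)} (hzb : dist z b ≤ 1) : gradedPool X D z b ≤ pooledDef X b := by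
  rw [pooledDef_eq_sum hX b]
  set T := (D.erase z).filter (fun y => dist b y ≤ 1) with hT
  have hzmem : z ∈ X.filter (fun x => dist b x ≤ 1) := mem_filter.2 ⟨hz, by rwa [dist_comm]⟩
  have hTsub : T ⊆ X.filter (fun x => dist b x ≤ 1) := fun y hy => mem_filter.2 ⟨hDX (mem_of_mem_erase (mem_filter.1 hy).1), (mem_filter.1 hy).2⟩
  have hzT : z ∉ T := fun h => notMem_erase z D (mem_filter.1 h).1
  have hins : insert z T ⊆ X.filter (fun x => dist b x ≤ 1) := insert_subset hzmem hTsub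
  have hzterm : (if z ∈ D then max 1 (gradedGain X z) else 1) ≤ (12 : ℝ) - ((X.filter fun q => dist z q = 1).card : ℝ) := by
    have h1 : (1 : ℝ) ≤ (12 : ℝ) - ((X.filter fun q => dist z q = 1).card : ℝ) := by
      have : ((X.filter fun q => dist z q = 1).card : ℝ) ≤ 11 := by exact_mod_cast hdeg
      linarith
    split_ifs
    · exact max_le h1 (gradedGain_le_deficiency hX z)
    · exact h1
  have hterms : ∀ y ∈ T, gradedGain X y ≤ (12 : ℝ) - ((X.filter fun q => dist y q = 1).card : ℝ) := fun y _ => gradedGain_le_deficiency hX y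
  have hnonneg : ∀ x ∈ X.filter (fun x => dist b x ≤ 1), x ∉ insert z T → (0 : ℝ) ≤ (12 : ℝ) - ((X.filter fun q => dist x q = 1).card : ℝ) := by
    intro x _ _
    have : ((X.filter fun q => dist x q = 1).card : ℝ) ≤ 12 := by exact_mod_cast card_filter_dist_eq_one_le_twelve X hX x
    linarith
  calc gradedPool X D z b
      = (if z ∈ D then max 1 (gradedGain X z) else 1) + ∑ y ∈ T, gradedGain X y := rfl
    _ ≤ ((12 : ℝ) - ((X.filter fun q => dist z q = 1).card : ℝ)) + ∑ y ∈ T, ((12 : ℝ) - ((X.filter fun q => dist y q = 1).card : ℝ)) :=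
        add_le_add hzterm (sum_le_sum hterms)
    _ = ∑ x ∈ insert z T, ((12 : ℝ) - ((X.filter fun q => dist x q = 1).card : ℝ)) := by rw [sum_insert hzT]
    _ ≤ ∑ x ∈ X.filter (fun x => dist b x ≤ 1), ((12 : ℝ) - ((X.filter fun q => dist x q = 1).card : ℝ)) :=
        sum_le_sum_of_subset_of_nonneg hins hnonneg

open scoped Classical in
/-- **Under `ThreePayer`, the floor-3 graded pool never exceeds the true pool** at an (A)-end ball within `1` of the payer. -/
theorem gradedPool₃_le_pooledDef (h3 : ThreePayer) {X D : Finset (EuclideanSpace ℝ (Fin 3))} (hX : ∀ p ∈ X, ∀ q ∈ X, p ≠ q → 1 ≤ dist p q) (hDX : D ⊆ X)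
    {z : EuclideanSpace ℝ (Fin 3)} (hz : z ∈ X) (hdeg : (X.filter fun q => dist z q = 1).card ≤ 11) {v : WordVersion} {S₁ S₂ : PlateSystem} (h₁ : S₁.RT ⊆ fccSlots)
    (h₂ : S₂.RT ⊆ fccSlots) {b q : EuclideanSpace ℝ (Fin 3)} (hzb : dist z b ≤ 1) (hp : IsEndPairA X v S₁ S₂ b q) : gradedPool₃ X D z b ≤ pooledDef X b := by
  unfold gradedPool₃
  split_ifs with hbz
  · exact gradedPool_le_pooledDef hX hDX hz hdeg hzb
  · exact max_le (h3 X hX z hz hdeg v S₁ S₂ h₁ h₂ b q hzb hbz hp) (gradedPool_le_pooledDef hX hDX hz hdeg hzb)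

/-! ### The comparison -/

open scoped Classical in
/-- **`Σ_A(Y, z) ≤ gradedSummand₃ Y (unionCoreStar Y z) z`** at every payer of degree `≤ 11`, under `ThreePayer` alone (no E1, no cap table). -/
theorem localSummandA_le_gradedSummand₃_unionCoreStar (h3 : ThreePayer) {Y : Finset (EuclideanSpace ℝ (Fin 3))} (hY : ∀ p ∈ Y, ∀ p' ∈ Y, p ≠ p' → 1 ≤ dist p p')
    {v : WordVersion} {S₁ S₂ : PlateSystem} (h₁ : S₁.RT ⊆ fccSlots) (h₂ : S₂.RT ⊆ fccSlots) {z : EuclideanSpace ℝ (Fin 3)} (hz : z ∈ Y)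
    (hdeg : (Y.filter fun q => dist z q = 1).card ≤ 11) :
    localSummandA v S₁ S₂ Y z ≤ gradedSummand₃ v S₁ S₂ Y (unionCoreStar Y z v S₁ S₂) z := by
  set D := unionCoreStar Y z v S₁ S₂ with hDdef
  have hDY : D ⊆ Y := (isStarClosed_unionCoreStar (Y := Y) (z := z) (v := v) (S₁ := S₁) (S₂ := S₂)).subset
  unfold localSummandA gradedSummand₃
  have hsub : Y.filter (fun b => dist z b ≤ 1 ∧ 0 < endMultA Y v S₁ S₂ b) ⊆ D.filter (fun b => dist z b ≤ 1 ∧ 0 < endMultA D v S₁ S₂ b) := by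
    intro b hb
    obtain ⟨-, hzb, he⟩ := mem_filter.1 hb
    have hle : endMultA Y v S₁ S₂ b ≤ endMultA D v S₁ S₂ b := endMultA_le_unionCoreStar hY h₁ h₂ hzb
    obtain ⟨q, hq⟩ := card_pos.1 he
    have hpD := isEndPairA_unionCoreStar hY h₁ h₂ hzb (mem_filter.1 hq).2
    exact mem_filter.2 ⟨hpD.2.1, hzb, lt_of_lt_of_le he hle⟩
  calc ∑ b ∈ Y.filter (fun b => dist z b ≤ 1 ∧ 0 < endMultA Y v S₁ S₂ b), (endMultA Y v S₁ S₂ b : ℝ) / pooledDef Y b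
      ≤ ∑ b ∈ Y.filter (fun b => dist z b ≤ 1 ∧ 0 < endMultA Y v S₁ S₂ b), (endMultA D v S₁ S₂ b : ℝ) / gradedPool₃ Y D z b := by
        refine sum_le_sum fun b hb => ?_
        obtain ⟨-, hzb, he⟩ := mem_filter.1 hb
        obtain ⟨q, hq⟩ := card_pos.1 he
        exact div_le_div₀ (Nat.cast_nonneg _) (Nat.cast_le.2 (endMultA_le_unionCoreStar hY h₁ h₂ hzb)) (gradedPool₃_pos Y D z b)
          (gradedPool₃_le_pooledDef h3 hY hDY hz hdeg h₁ h₂ hzb (mem_filter.1 hq).2)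
    _ ≤ ∑ b ∈ D.filter (fun b => dist z b ≤ 1 ∧ 0 < endMultA D v S₁ S₂ b), (endMultA D v S₁ S₂ b : ℝ) / gradedPool₃ Y D z b :=
        sum_le_sum_of_subset_of_nonneg hsub fun b _ _ => div_nonneg (Nat.cast_nonneg _) (gradedPool₃_pos Y D z b).le

/-! ### The certificate of record to build and the by-name consequences -/

open scoped Classical in
/-- **STAR-CLOSED UNION-CORE CERTIFICATE WITH THE GRADED ROW, FLOOR 3, WINDOW FORM (named input — lane F's T5b row certificate of record to build, cf-p1
(cclxxxviii)(1))**: for every finite `1`-separated `Y ⊆ B̄(0, 3)` containing the payer `0` with degree `≤ 11`, the graded floor-3 (A)-summand (`v2`, standard systems)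
of the star-closed union core of `0` is `≤ s`.  MONOTONE IN JUNK by construction (each junk contact costs exactly one unit on one ball). -/
def UnionCoreGradedCapWin₃ (s : ℝ) : Prop :=
  ∀ Y : Finset (EuclideanSpace ℝ (Fin 3)), (∀ y ∈ Y, dist (0 : EuclideanSpace ℝ (Fin 3)) y ≤ 3) → (∀ p ∈ Y, ∀ q ∈ Y, p ≠ q → 1 ≤ dist p q) →
  (0 : EuclideanSpace ℝ (Fin 3)) ∈ Y → (Y.filter fun q => dist (0 : EuclideanSpace ℝ (Fin 3)) q = 1).card ≤ 11 →
    gradedSummand₃ WordVersion.v2 (basalSystem (LinearIsometryEquiv.refl ℝ (EuclideanSpace ℝ (Fin 3)))) (basalSystem (ℝ ∙ EuclideanSpace.single (2 : Fin 3) (1 : ℝ)).reflection) Y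
      (unionCoreStar Y 0 WordVersion.v2 (basalSystem (LinearIsometryEquiv.refl ℝ (EuclideanSpace ℝ (Fin 3))))
        (basalSystem (ℝ ∙ EuclideanSpace.single (2 : Fin 3) (1 : ℝ)).reflection)) 0 ≤ s

/-- Monotonicity in the line. -/
theorem unionCoreGradedCapWin₃_mono {s s' : ℝ} (h : UnionCoreGradedCapWin₃ s) (hs : s ≤ s') : UnionCoreGradedCapWin₃ s' :=
  fun Y hW hY h0 hdeg => (h Y hW hY h0 hdeg).trans hs

open scoped Classical in
/-- **`ThreePayer → UnionCoreGradedCapWin₃ s → Σ_A(Y, z) ≤ s` for EVERY frame and payer** (transport `z ↦ 0`, `L ↦ refl`; radius-`3` locality). -/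
theorem localSummandA_le_of_threePayer_of_gradedWin₃ (h3 : ThreePayer) {s : ℝ} (h : UnionCoreGradedCapWin₃ s)
    (L : EuclideanSpace ℝ (Fin 3) ≃ₗᵢ[ℝ] EuclideanSpace ℝ (Fin 3)) {Y : Finset (EuclideanSpace ℝ (Fin 3))} (hY : ∀ p ∈ Y, ∀ q ∈ Y, p ≠ q → 1 ≤ dist p q)
    {z : EuclideanSpace ℝ (Fin 3)} (hz : z ∈ Y) (hdeg : (Y.filter fun q => dist z q = 1).card ≤ 11) :
    localSummandA WordVersion.v2 (basalSystem L) (basalSystem (((ℝ ∙ EuclideanSpace.single (2 : Fin 3) (1 : ℝ)).reflection).trans L)) Y z ≤ s := by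
  set H : EuclideanSpace ℝ (Fin 3) ≃ₗᵢ[ℝ] EuclideanSpace ℝ (Fin 3) := (ℝ ∙ EuclideanSpace.single (2 : Fin 3) (1 : ℝ)).reflection with hH
  set X := Y.image fun y => L.symm y + -L.symm z with hXdef
  have hX : ∀ p ∈ X, ∀ q ∈ X, p ≠ q → 1 ≤ dist p q := separated_image_rigid hY L.symm _
  have hYX : Y = X.image fun x => L x + z := by
    have e := image_rigid_symm Y L.symm (-L.symm z)
    simp only [LinearIsometryEquiv.symm_symm, map_neg, LinearIsometryEquiv.apply_symm_apply, neg_neg] at e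
    rw [hXdef, e]
  have h0 : (0 : EuclideanSpace ℝ (Fin 3)) ∈ X := mem_image.2 ⟨z, hz, by simp⟩
  have hzz : z = L 0 + z := by simp
  have hdeg0 : (X.filter fun q => dist (0 : EuclideanSpace ℝ (Fin 3)) q = 1).card ≤ 11 := by
    rw [← degree_transport X L z 0, ← hYX, ← hzz]; exact hdeg
  have key := localSummandA_transport X L z WordVersion.v2 (LinearIsometryEquiv.refl ℝ (EuclideanSpace ℝ (Fin 3))) H basalHexagon basalHexagon 0
  rw [← hYX, ← hzz, LinearIsometryEquiv.refl_trans] at key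
  change localSummandA WordVersion.v2 ⟨L, basalHexagon⟩ ⟨H.trans L, basalHexagon⟩ Y z ≤ s
  rw [key]
  set X₀ := X.filter fun x => dist (0 : EuclideanSpace ℝ (Fin 3)) x ≤ 3 with hX₀def
  have hagree : ∀ x, dist (0 : EuclideanSpace ℝ (Fin 3)) x ≤ 3 → (x ∈ X ↔ x ∈ X₀) := fun x hx => by
    rw [hX₀def, mem_filter]; exact ⟨fun h => ⟨h, hx⟩, fun h => h.1⟩
  have h₁ : (basalSystem (LinearIsometryEquiv.refl ℝ (EuclideanSpace ℝ (Fin 3)))).RT ⊆ fccSlots := filter_subset _ _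
  have h₂ : (basalSystem H).RT ⊆ fccSlots := filter_subset _ _
  have hloc := localSummandA_congr_of_agree (v := WordVersion.v2) hagree h₁ h₂ (z := 0) (by simp)
  change localSummandA WordVersion.v2 (basalSystem (LinearIsometryEquiv.refl ℝ (EuclideanSpace ℝ (Fin 3)))) (basalSystem H) X 0 ≤ s
  rw [hloc]
  have hX₀ : ∀ p ∈ X₀, ∀ q ∈ X₀, p ≠ q → 1 ≤ dist p q := fun p hp q hq hne => hX p (mem_filter.1 hp).1 q (mem_filter.1 hq).1 hne
  have hW : ∀ y ∈ X₀, dist (0 : EuclideanSpace ℝ (Fin 3)) y ≤ 3 := fun y hy => (mem_filter.1 hy).2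
  have h00 : (0 : EuclideanSpace ℝ (Fin 3)) ∈ X₀ := mem_filter.2 ⟨h0, by simp⟩
  have hdeg00 : (X₀.filter fun q => dist (0 : EuclideanSpace ℝ (Fin 3)) q = 1).card ≤ 11 := by
    rw [← degree_congr_of_agree hagree (y := 0) (by simp)]; exact hdeg0
  exact (localSummandA_le_gradedSummand₃_unionCoreStar h3 hX₀ h₁ h₂ h00 hdeg00).trans (h X₀ hW hX₀ h00 hdeg00)

/-- **`ThreePayer → UnionCoreGradedCapWin₃ s → SeamResidual s k₀`.** -/
theorem seamResidual_of_threePayer_of_gradedWin₃ (h3 : ThreePayer) {s : ℝ} {k₀ : ℕ} (h : UnionCoreGradedCapWin₃ s) : SeamResidual s k₀ :=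
  fun L _ hY _ hz hdeg _ _ _ _ => Or.inr (localSummandA_le_of_threePayer_of_gradedWin₃ h3 h L hY hz hdeg)

/-- **`ThreePayer → UnionCoreGradedCapWin₃ s → CoherentSeamSmall s k₀`.** -/
theorem coherentSeamSmall_of_threePayer_of_gradedWin₃ (h3 : ThreePayer) {s : ℝ} {k₀ : ℕ} (h : UnionCoreGradedCapWin₃ s) : CoherentSeamSmall s k₀ :=
  fun L _ hY _ hz hdeg _ _ _ _ _ => Or.inr (localSummandA_le_of_threePayer_of_gradedWin₃ h3 h L hY hz hdeg)

/-- **`ThreePayer → UnionCoreGradedCapWin₃ s → IncoherentSeamSmall s k₀`.** -/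
theorem incoherentSeamSmall_of_threePayer_of_gradedWin₃ (h3 : ThreePayer) {s : ℝ} {k₀ : ℕ} (h : UnionCoreGradedCapWin₃ s) : IncoherentSeamSmall s k₀ :=
  fun L _ hY _ hz hdeg _ _ _ _ _ => Or.inr (localSummandA_le_of_threePayer_of_gradedWin₃ h3 h L hY hz hdeg)

/-- **The by-name closer for lane F (cf-p1 (cclxxxviii)(2))**: `stub_threePayer : ThreePayer` and a registered `stub_unionCoreGradedCapWin3 : UnionCoreGradedCapWin₃ (2√6)`
close both T5b stubs at `k₀ = 3` — no E1 needed. -/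
theorem t5b_of_threePayer_of_gradedWin₃ (h3 : ThreePayer) (h : UnionCoreGradedCapWin₃ (2 * Real.sqrt 6)) :
    CoherentSeamSmall (2 * Real.sqrt 6) 3 ∧ IncoherentSeamSmall (2 * Real.sqrt 6) 3 :=
  ⟨coherentSeamSmall_of_threePayer_of_gradedWin₃ h3 h, incoherentSeamSmall_of_threePayer_of_gradedWin₃ h3 h⟩

/-- The same closer in the shape cf-p1 wrote in (cclxxxviii)(1), with the (unused) E1 hypothesis in front. -/
theorem t5b_of_threePayer_of_gradedWin₃' (_ : P5Exhaustion) (h3 : ThreePayer) (h : UnionCoreGradedCapWin₃ (2 * Real.sqrt 6)) :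
    CoherentSeamSmall (2 * Real.sqrt 6) 3 ∧ IncoherentSeamSmall (2 * Real.sqrt 6) 3 :=
  t5b_of_threePayer_of_gradedWin₃ h3 h

end TailResidue

end Summit.Ventures.Crystal3D.Theorems

end
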